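import Literature.NumberTheory.Rogawski1990.ArchCentralLimitFunctionalNoncompactWall  -- ★ p843006 (A-p18 (g25)): `iteratedDeriv_three_smul_eq_iteratedFDeriv`, `continuousAt_iteratedDeriv_comp_line_smul`; brings ★ WallAlgebra, ★ RayJetsOneSided
import Literature.NumberTheory.Rogawski1990.ArchCentralLimitChamberReduction         -- ★ p843009 (F0P3a-p02 (g12)): `angleChart_mul_exp_ray`, the `of_chamberExtensions` token
import HarnessLib

/-!
# The corner transfer at the COMPACT wall for the archimedean central-limit functional

Rogawski, *Automorphic representations of unitary groups in three variables* (1990), §8.4 pp. 126–127: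
Harish-Chandra's limit formula at the centre `ζ·1` of `U(2,1)`, read chamber by chamber (★
`ArchCentralLimitFormulaRankTwo.of_chamberExtensions`: for each Weyl chamber `C_σ` a `C³` corner
extension `H` of `F_Θ∘chart|_{C_σ}` and the value `Λ₈^∠[H](0)`).  For the four chambers ADJACENT TO THE
COMPACT WALL `{θ₀ = θ₁}` (compact root `e₀ − e₁`, centraliser `U(2) × U(1)`; `F_Θ` has NO jump across it)
this file expresses the corner value `Λ₈^∠[H](0)` as a limit ALONG THE WALL of the two wall jets of the
honest function `f = F_Θ∘chart`:

* §1 `Λ₈^∠[H](0) = ¼·(D³H(0)[A⃗,A⃗,N⃗] − D³H(0)[N⃗,N⃗,N⃗])`, `N⃗ = (1,−1,0)` (wall normal = coroot),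
  `A⃗ = (1,1,−2)` (wall tangent), and its jet form
  `¼·((d/dt)²|₀(d/ds)|₀ H(tA⃗ + sN⃗) − (d/ds)³|₀ H(sN⃗))` — the compact-wall twins of ★
  `lambda8Angle_zero_eq_quarter_wall02_form/jets` (★ `sum_sign_cube_signedRay_eq_of_symmetric`);
* §2 jets agree on the common boundary: if `H = f` on an open `S`, `H ∈ C³(U)`, `f ∈ C³(W)` and
  `x ∈ U ∩ W ∩ closure S`, then `D³H(x) = D³f(x)`;
* §3 **the transfer**: along any filter `l ≤ 𝓝 0` on the wall parameter with `t•A⃗ ∈ U ∩ W ∩ closure S`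
  eventually, `¼·((d/dτ)²|₀(d/ds)|₀ f(tA⃗ + τA⃗ + sN⃗) − (d/ds)³|₀ f(tA⃗ + sN⃗)) → Λ₈^∠[H](0)`;
* §4 the torus dictionary `f(tA⃗ + sN⃗) = F(k_t·e^{isN⃗})`, `k_t = ζ·e^{itA⃗}` a compact-wall point
  (`(k_t)₀ = (k_t)₁`), so that ★ `ArchCentralLimitCompactWallLeibniz` (`NF`, `N²F = 0`, `N³F` at `k_t`)
  applies verbatim to the two wall jets.

So for the compact-adjacent chambers the letter's constant is `¼·lim_{t→0±}((d/dτ)²NF − N³F)(k_t)`,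
computable from `Φ(k_w)`, `N²Φ(k_w)` as `w → 1` ((A2″)/(A3)) — given the (A6) corner extension `H`.
-/

open Filter Topology Set
open Literature.Analysis.Calculus

namespace Literature.NumberTheory.Rogawski1990

/-! ## §1 The corner value in compact-wall-adapted form -/

section Corner

/-- **THE CORNER VALUE IN WALL-ADAPTED FORM (compact wall `θ₀ = θ₁`).**  For `H` of class `C³` on an open `U ∋ 0`:
`Λ₈^∠[H](0) = ¼·(D³H(0)(A⃗,A⃗,N⃗) − D³H(0)(N⃗,N⃗,N⃗))`, `N⃗ = (1,−1,0)`, `A⃗ = (1,1,−2)` (★ `sum_sign_cube_signedRay_eq_of_symmetric`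
at `m = D³H(0)`, symmetric by ★ `iteratedFDeriv_comp_perm_of_le`). [cite: Rogawski1990, §8.4 pp. 126–127] -/
theorem lambda8Angle_zero_eq_quarter_wall01_form (H : (Fin 3 → ℝ) → ℂ) {U : Set (Fin 3 → ℝ)} (hU : IsOpen U) (h0 : (0 : Fin 3 → ℝ) ∈ U)
    (hH : ContDiffOn ℝ 3 H U) :
    (1 / 48 : ℂ) * ∑ ε : Fin 3 → Bool, ((((if ε 0 then (1 : ℝ) else -1) * (if ε 1 then (1 : ℝ) else -1) * (if ε 2 then (1 : ℝ) else -1) : ℝ)) : ℂ) *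
        iteratedDeriv 3 (fun s : ℝ => H (s • (![(if ε 0 then (1 : ℝ) else -1) + (if ε 1 then (1 : ℝ) else -1), -(if ε 0 then (1 : ℝ) else -1) + (if ε 2 then (1 : ℝ) else -1),
          -(if ε 1 then (1 : ℝ) else -1) - (if ε 2 then (1 : ℝ) else -1)]))) 0 =
      (1 / 4 : ℂ) * (iteratedFDeriv ℝ 3 H 0 ![![1, 1, -2], ![1, 1, -2], ![1, -1, 0]] - iteratedFDeriv ℝ 3 H 0 ![![1, -1, 0], ![1, -1, 0], ![1, -1, 0]]) := by
  simp only [iteratedDeriv_three_smul_eq_iteratedFDeriv H hU h0 hH]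
  have hsym : ∀ (v : Fin 3 → (Fin 3 → ℝ)) (σ : Equiv.Perm (Fin 3)), iteratedFDeriv ℝ 3 H 0 (v ∘ σ) = iteratedFDeriv ℝ 3 H 0 v := fun v σ =>
    iteratedFDeriv_comp_perm_of_le (𝕜 := ℝ) (hH.contDiffAt (hU.mem_nhds h0)) le_rfl v σ
  rw [sum_sign_cube_signedRay_eq_of_symmetric _ hsym]
  ring

/-- **THE CORNER VALUE IN WALL JETS (compact wall `θ₀ = θ₁`).**  For `H` of class `C³` on an open `U ∋ 0`:
`Λ₈^∠[H](0) = ¼·((d∕dt)²|₀ (d∕ds)|₀ H(tA⃗ + sN⃗) − (d∕ds)³|₀ H(sN⃗))` — the second tangential derivative ALONG THE WALL of the first normal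
derivative, minus the normal cube (★ `iteratedDeriv_two_deriv_comp_plane_eq` for the mixed reading). [cite: Rogawski1990, §8.4 pp. 126–127] -/
theorem lambda8Angle_zero_eq_quarter_wall01_jets (H : (Fin 3 → ℝ) → ℂ) {U : Set (Fin 3 → ℝ)} (hU : IsOpen U) (h0 : (0 : Fin 3 → ℝ) ∈ U)
    (hH : ContDiffOn ℝ 3 H U) :
    (1 / 48 : ℂ) * ∑ ε : Fin 3 → Bool, ((((if ε 0 then (1 : ℝ) else -1) * (if ε 1 then (1 : ℝ) else -1) * (if ε 2 then (1 : ℝ) else -1) : ℝ)) : ℂ) *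
        iteratedDeriv 3 (fun s : ℝ => H (s • (![(if ε 0 then (1 : ℝ) else -1) + (if ε 1 then (1 : ℝ) else -1), -(if ε 0 then (1 : ℝ) else -1) + (if ε 2 then (1 : ℝ) else -1),
          -(if ε 1 then (1 : ℝ) else -1) - (if ε 2 then (1 : ℝ) else -1)]))) 0 =
      (1 / 4 : ℂ) * (iteratedDeriv 2 (fun t : ℝ => deriv (fun s : ℝ => H ((0 : Fin 3 → ℝ) + t • (![1, 1, -2] : Fin 3 → ℝ) + s • (![1, -1, 0] : Fin 3 → ℝ))) 0) 0
        - iteratedDeriv 3 (fun s : ℝ => H (s • (![1, -1, 0] : Fin 3 → ℝ))) 0) := by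
  have hv : (fun _ : Fin 3 => (![1, -1, 0] : Fin 3 → ℝ)) = ![![1, -1, 0], ![1, -1, 0], ![1, -1, 0]] := by
    funext i
    fin_cases i <;> rfl
  rw [lambda8Angle_zero_eq_quarter_wall01_form H hU h0 hH, iteratedDeriv_three_smul_eq_iteratedFDeriv H hU h0 hH, hv,
    iteratedDeriv_two_deriv_comp_plane_eq hU hH le_rfl h0 (![1, 1, -2] : Fin 3 → ℝ) (![1, -1, 0] : Fin 3 → ℝ)]

end Corner

/-! ## §2 Jets agree on the common boundary of the region of agreement -/

section Boundary

variable {E F : Type*} [NormedAddCommGroup E] [NormedSpace ℝ E] [NormedAddCommGroup F] [NormedSpace ℝ F]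

/-- The `n`-th Fréchet derivative of a function of class `Cⁿ` on an open `U` is continuous at every point of `U`.
[cite: Rogawski1990, §8.4 p. 126] -/
theorem continuousAt_iteratedFDeriv_of_contDiffOn {f : E → F} {U : Set E} (hU : IsOpen U) {n : ℕ} (hf : ContDiffOn ℝ n f U)
    {x : E} (hx : x ∈ U) : ContinuousAt (iteratedFDeriv ℝ n f) x := by
  have hc : ContinuousOn (iteratedFDerivWithin ℝ n f U) U := hf.continuousOn_iteratedFDerivWithin le_rfl hU.uniqueDiffOn
  have hcx : ContinuousAt (iteratedFDerivWithin ℝ n f U) x := hc.continuousAt (hU.mem_nhds hx)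
  refine hcx.congr ?_
  filter_upwards [hU.mem_nhds hx] with y hy
  exact iteratedFDerivWithin_of_isOpen n hU hy

/-- **JETS AGREE ON THE BOUNDARY.**  If `H = f` on an open set `S`, `H` is `Cⁿ` on an open `U`, `f` is `Cⁿ` on an open `W`, and
`x ∈ U ∩ W` lies in the closure of `S`, then `DⁿH(x) = Dⁿf(x)` (both jets are continuous at `x` and agree on the open set
`S ∩ U ∩ W`, which accumulates at `x`).  At a compact-wall point this identifies the jets of a chamber extension with those of
`F_Θ∘chart` itself. [cite: Rogawski1990, §8.4 pp. 126–127] -/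
theorem iteratedFDeriv_eq_of_eqOn_of_mem_closure {H f : E → F} {S U W : Set E} (hS : IsOpen S) (hHf : EqOn H f S)
    (hU : IsOpen U) (hW : IsOpen W) {n : ℕ} (hH : ContDiffOn ℝ n H U) (hf : ContDiffOn ℝ n f W)
    {x : E} (hxU : x ∈ U) (hxW : x ∈ W) (hx : x ∈ closure S) :
    iteratedFDeriv ℝ n H x = iteratedFDeriv ℝ n f x := by
  -- the open set `S ∩ (U ∩ W)` accumulates at `x`
  have hx' : x ∈ closure (S ∩ (U ∩ W)) := (hU.inter hW).closure_inter ⟨hx, hxU, hxW⟩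
  haveI : (𝓝[S ∩ (U ∩ W)] x).NeBot := mem_closure_iff_nhdsWithin_neBot.1 hx'
  have hH' : Tendsto (iteratedFDeriv ℝ n H) (𝓝[S ∩ (U ∩ W)] x) (𝓝 (iteratedFDeriv ℝ n H x)) :=
    (continuousAt_iteratedFDeriv_of_contDiffOn hU hH hxU).tendsto.mono_left nhdsWithin_le_nhds
  have hf' : Tendsto (iteratedFDeriv ℝ n f) (𝓝[S ∩ (U ∩ W)] x) (𝓝 (iteratedFDeriv ℝ n f x)) :=
    (continuousAt_iteratedFDeriv_of_contDiffOn hW hf hxW).tendsto.mono_left nhdsWithin_le_nhds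
  refine tendsto_nhds_unique_of_eventuallyEq hH' hf' ?_
  filter_upwards [self_mem_nhdsWithin] with y hy
  have hloc : H =ᶠ[𝓝 y] f := Filter.eventuallyEq_of_mem (hS.mem_nhds hy.1) hHf
  exact (hloc.iteratedFDeriv ℝ n).eq_of_nhds

end Boundary

/-! ## §3 The transfer: corner value of the extension = limit of the wall jets of `f` along the compact wall -/

section Transfer

/-- The wall jets of a `C³` function at a base point `x ∈ U`, read as values of `D³`: the normal cube. [cite: Rogawski1990, §8.4 p. 126] -/
theorem iteratedDeriv_three_line_eq_iteratedFDeriv (f : (Fin 3 → ℝ) → ℂ) {U : Set (Fin 3 → ℝ)} (hU : IsOpen U) (hf : ContDiffOn ℝ 3 f U)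
    {x : Fin 3 → ℝ} (hx : x ∈ U) (N : Fin 3 → ℝ) :
    iteratedDeriv 3 (fun s : ℝ => f (x + s • N)) 0 = iteratedFDeriv ℝ 3 f x ![N, N, N] := by
  have hv : (fun _ : Fin 3 => N) = ![N, N, N] := by
    funext i
    fin_cases i <;> rfl
  rw [iteratedDeriv_comp_line_zero_of_le hU hf hx N (k := 3) le_rfl, hv]

/-- **THE CORNER TRANSFER AT THE COMPACT WALL.**  Let `H` be of class `C³` on an open `U ∋ 0` (a chamber extension: `H = f` on the open
chamber `S`), `f` of class `C³` on an open `W` (the honest `F_Θ∘chart`, smooth across the compact wall away from the corner), and let `l ≤ 𝓝 0`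
be a filter on the wall parameter along which `t•A⃗ ∈ U ∩ W ∩ closure S` (`l = 𝓝[>] 0` or `𝓝[<] 0` for the four compact-adjacent chambers).
THEN `¼·((d∕dτ)²|₀(d∕ds)|₀ f(tA⃗ + τA⃗ + sN⃗) − (d∕ds)³|₀ f(tA⃗ + sN⃗)) → Λ₈^∠[H](0)` along `l`: the corner value of the extension is the limit ALONG
THE COMPACT WALL of the two wall jets of `f`. [cite: Rogawski1990, §8.4 pp. 126–127] [cite: Varadarajan1989, §6.4] -/
theorem tendsto_quarter_wall01_jets_of_cornerExtension (H f : (Fin 3 → ℝ) → ℂ) {S U W : Set (Fin 3 → ℝ)}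
    (hS : IsOpen S) (hHf : EqOn H f S) (hU : IsOpen U) (h0 : (0 : Fin 3 → ℝ) ∈ U) (hH : ContDiffOn ℝ 3 H U)
    (hW : IsOpen W) (hf : ContDiffOn ℝ 3 f W) {l : Filter ℝ} (hl : l ≤ 𝓝 0)
    (hwall : ∀ᶠ t in l, t • (![1, 1, -2] : Fin 3 → ℝ) ∈ U ∧ t • (![1, 1, -2] : Fin 3 → ℝ) ∈ W ∧ t • (![1, 1, -2] : Fin 3 → ℝ) ∈ closure S) :
    Tendsto (fun t : ℝ => (1 / 4 : ℂ) *
        (iteratedDeriv 2 (fun τ : ℝ => deriv (fun s : ℝ => f (t • (![1, 1, -2] : Fin 3 → ℝ) + τ • (![1, 1, -2] : Fin 3 → ℝ) + s • (![1, -1, 0] : Fin 3 → ℝ))) 0) 0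
          - iteratedDeriv 3 (fun s : ℝ => f (t • (![1, 1, -2] : Fin 3 → ℝ) + s • (![1, -1, 0] : Fin 3 → ℝ))) 0)) l
      (𝓝 ((1 / 48 : ℂ) * ∑ ε : Fin 3 → Bool, ((((if ε 0 then (1 : ℝ) else -1) * (if ε 1 then (1 : ℝ) else -1) * (if ε 2 then (1 : ℝ) else -1) : ℝ)) : ℂ) *
        iteratedDeriv 3 (fun s : ℝ => H (s • (![(if ε 0 then (1 : ℝ) else -1) + (if ε 1 then (1 : ℝ) else -1), -(if ε 0 then (1 : ℝ) else -1) + (if ε 2 then (1 : ℝ) else -1),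
          -(if ε 1 then (1 : ℝ) else -1) - (if ε 2 then (1 : ℝ) else -1)]))) 0)) := by
  set A : Fin 3 → ℝ := ![1, 1, -2] with hA
  set N : Fin 3 → ℝ := ![1, -1, 0] with hN
  rw [lambda8Angle_zero_eq_quarter_wall01_form H hU h0 hH]
  -- the line `t ↦ t•A` tends to the corner along `l`
  have hline : Tendsto (fun t : ℝ => t • A) l (𝓝 0) := by
    have hc : Continuous fun t : ℝ => t • A := by fun_prop
    simpa only [zero_smul] using (hc.tendsto 0).mono_left hl
  -- `D³H` is continuous at the corner, so `D³H(tA) → D³H(0)` along `l`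
  have hD : Tendsto (fun t : ℝ => iteratedFDeriv ℝ 3 H (t • A)) l (𝓝 (iteratedFDeriv ℝ 3 H 0)) :=
    (continuousAt_iteratedFDeriv_of_contDiffOn hU hH h0).tendsto.comp hline
  have hDAAN : Tendsto (fun t : ℝ => iteratedFDeriv ℝ 3 H (t • A) ![A, A, N]) l (𝓝 (iteratedFDeriv ℝ 3 H 0 ![A, A, N])) :=
    ((ContinuousMultilinearMap.apply ℝ (fun _ : Fin 3 => Fin 3 → ℝ) ℂ ![A, A, N]).continuous.tendsto _).comp hD
  have hDNNN : Tendsto (fun t : ℝ => iteratedFDeriv ℝ 3 H (t • A) ![N, N, N]) l (𝓝 (iteratedFDeriv ℝ 3 H 0 ![N, N, N])) :=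
    ((ContinuousMultilinearMap.apply ℝ (fun _ : Fin 3 => Fin 3 → ℝ) ℂ ![N, N, N]).continuous.tendsto _).comp hD
  have hlim := (hDAAN.sub hDNNN).const_mul (1 / 4 : ℂ)
  refine hlim.congr' ?_
  -- along `l`, the wall jets of `f` at `tA` ARE `D³H(tA)` applied to `(A,A,N)` and `(N,N,N)`
  filter_upwards [hwall] with t ht
  obtain ⟨htU, htW, htS⟩ := ht
  have hjet : iteratedFDeriv ℝ 3 H (t • A) = iteratedFDeriv ℝ 3 f (t • A) :=
    iteratedFDeriv_eq_of_eqOn_of_mem_closure hS hHf hU hW hH hf htU htW htS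
  rw [iteratedDeriv_two_deriv_comp_plane_eq hW hf le_rfl htW A N, iteratedDeriv_three_line_eq_iteratedFDeriv f hW hf htW N, hjet]

/-- The same transfer with the conclusion's two wall jets SEPARATED: the normal cube of `f` at `tA⃗` tends to `D³H(0)(N⃗,N⃗,N⃗)` and the mixed
jet to `D³H(0)(A⃗,A⃗,N⃗)` (useful when the two (A2″)∕(A3) asymptotics arrive separately). [cite: Rogawski1990, §8.4 pp. 126–127] -/
theorem tendsto_wall01_jets_of_cornerExtension (H f : (Fin 3 → ℝ) → ℂ) {S U W : Set (Fin 3 → ℝ)}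
    (hS : IsOpen S) (hHf : EqOn H f S) (hU : IsOpen U) (h0 : (0 : Fin 3 → ℝ) ∈ U) (hH : ContDiffOn ℝ 3 H U)
    (hW : IsOpen W) (hf : ContDiffOn ℝ 3 f W) {l : Filter ℝ} (hl : l ≤ 𝓝 0)
    (hwall : ∀ᶠ t in l, t • (![1, 1, -2] : Fin 3 → ℝ) ∈ U ∧ t • (![1, 1, -2] : Fin 3 → ℝ) ∈ W ∧ t • (![1, 1, -2] : Fin 3 → ℝ) ∈ closure S) :
    Tendsto (fun t : ℝ => iteratedDeriv 3 (fun s : ℝ => f (t • (![1, 1, -2] : Fin 3 → ℝ) + s • (![1, -1, 0] : Fin 3 → ℝ))) 0) l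
        (𝓝 (iteratedFDeriv ℝ 3 H 0 ![![1, -1, 0], ![1, -1, 0], ![1, -1, 0]])) ∧
      Tendsto (fun t : ℝ => iteratedDeriv 2 (fun τ : ℝ => deriv (fun s : ℝ =>
          f (t • (![1, 1, -2] : Fin 3 → ℝ) + τ • (![1, 1, -2] : Fin 3 → ℝ) + s • (![1, -1, 0] : Fin 3 → ℝ))) 0) 0) l
        (𝓝 (iteratedFDeriv ℝ 3 H 0 ![![1, 1, -2], ![1, 1, -2], ![1, -1, 0]])) := by
  set A : Fin 3 → ℝ := ![1, 1, -2] with hA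
  set N : Fin 3 → ℝ := ![1, -1, 0] with hN
  have hline : Tendsto (fun t : ℝ => t • A) l (𝓝 0) := by
    have hc : Continuous fun t : ℝ => t • A := by fun_prop
    simpa only [zero_smul] using (hc.tendsto 0).mono_left hl
  have hD : Tendsto (fun t : ℝ => iteratedFDeriv ℝ 3 H (t • A)) l (𝓝 (iteratedFDeriv ℝ 3 H 0)) :=
    (continuousAt_iteratedFDeriv_of_contDiffOn hU hH h0).tendsto.comp hline
  have hjets : ∀ᶠ t in l, iteratedFDeriv ℝ 3 H (t • A) = iteratedFDeriv ℝ 3 f (t • A) ∧ t • A ∈ W := by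
    filter_upwards [hwall] with t ht
    exact ⟨iteratedFDeriv_eq_of_eqOn_of_mem_closure hS hHf hU hW hH hf ht.1 ht.2.1 ht.2.2, ht.2.1⟩
  refine ⟨?_, ?_⟩
  · have h := ((ContinuousMultilinearMap.apply ℝ (fun _ : Fin 3 => Fin 3 → ℝ) ℂ ![N, N, N]).continuous.tendsto _).comp hD
    refine h.congr' ?_
    filter_upwards [hjets] with t ht
    simp only [Function.comp_apply, ContinuousMultilinearMap.apply_apply]
    rw [iteratedDeriv_three_line_eq_iteratedFDeriv f hW hf ht.2 N, ht.1]
  · have h := ((ContinuousMultilinearMap.apply ℝ (fun _ : Fin 3 => Fin 3 → ℝ) ℂ ![A, A, N]).continuous.tendsto _).comp hD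
    refine h.congr' ?_
    filter_upwards [hjets] with t ht
    simp only [Function.comp_apply, ContinuousMultilinearMap.apply_apply]
    rw [iteratedDeriv_two_deriv_comp_plane_eq hW hf le_rfl ht.2 A N, ht.1]

end Transfer

/-! ## §4 The torus dictionary: wall jets of `f = F∘chart_ζ` are the normal-ray jets of `F` at the wall point `k_t = ζ·e^{itA⃗}` -/

section Dictionary

/-- The base point `k_t = ζ·e^{itA⃗}`, `A⃗ = (1,1,−2)`, is a COMPACT-WALL point: `(k_t)₀ = (k_t)₁`. [cite: Rogawski1990, §8.4 p. 126] -/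
theorem angleChart_wall01_apply_zero_eq_one (ζ : Circle) (t : ℝ) :
    (fun j : Fin 3 => ζ * Circle.exp ((t • (![1, 1, -2] : Fin 3 → ℝ)) j)) 0 = (fun j : Fin 3 => ζ * Circle.exp ((t • (![1, 1, -2] : Fin 3 → ℝ)) j)) 1 := by
  simp

/-- **Torus dictionary for the normal ray at a wall point**: `chart_ζ(tA⃗ + sN⃗) = k_t·e^{isN⃗}` componentwise, `k_t = ζ·e^{itA⃗}` — so
`s ↦ F(chart_ζ(tA⃗ + sN⃗))` is LITERALLY the normal-ray function of ★ `ArchCentralLimitCompactWallLeibniz` at the wall point `k_t`.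
[cite: Rogawski1990, §8.4 p. 126] -/
theorem angleChart_wall01_add_normal (ζ : Circle) (t s : ℝ) :
    (fun j : Fin 3 => ζ * Circle.exp ((t • (![1, 1, -2] : Fin 3 → ℝ) + s • (![1, -1, 0] : Fin 3 → ℝ)) j)) =
      fun j : Fin 3 => (fun i : Fin 3 => ζ * Circle.exp ((t • (![1, 1, -2] : Fin 3 → ℝ)) i)) j * Circle.exp (s * (![1, -1, 0] : Fin 3 → ℝ) j) := by
  funext j
  rw [angleChart_mul_exp_ray ζ (![1, -1, 0] : Fin 3 → ℝ) (t • (![1, 1, -2] : Fin 3 → ℝ)) s j, add_comm]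

/-- **The normal cube through the dictionary**: `(d∕ds)³|₀ F(chart_ζ(tA⃗ + sN⃗)) = (d∕ds)³|₀ F(k_t·e^{isN⃗})`. [cite: Rogawski1990, §8.4 p. 126] -/
theorem iteratedDeriv_angleChart_wall01_normal (F : (Fin 3 → Circle) → ℂ) (ζ : Circle) (t : ℝ) (n : ℕ) :
    iteratedDeriv n (fun s : ℝ => F (fun j : Fin 3 => ζ * Circle.exp ((t • (![1, 1, -2] : Fin 3 → ℝ) + s • (![1, -1, 0] : Fin 3 → ℝ)) j))) 0 =
      iteratedDeriv n (fun s : ℝ => F (fun j : Fin 3 =>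
        (fun i : Fin 3 => ζ * Circle.exp ((t • (![1, 1, -2] : Fin 3 → ℝ)) i)) j * Circle.exp (s * (![1, -1, 0] : Fin 3 → ℝ) j))) 0 := by
  simp only [angleChart_wall01_add_normal]

end Dictionary

end Literature.NumberTheory.Rogawski1990
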